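import Mathlib.Analysis.Calculus.Taylor
import Mathlib.Analysis.SpecialFunctions.Integrals.Basic
import Mathlib.Analysis.SpecialFunctions.Integrability.Basic
import Mathlib.Analysis.SpecialFunctions.Pow.Continuity
import Mathlib.MeasureTheory.Integral.DominatedConvergence
import HarnessLib

/-!
# Binoth–Heinrich 2000, Part III «Extraction of the poles»: the per-variable Taylor subtraction of a sector integrand — PROVED

Source [BinothHeinrich2000]: T. Binoth, G. Heinrich, "An automatized algorithm to compute infrared divergent
multi-loop integrals", Nucl. Phys. B 585 (2000) 741–759, doi:10.1016/s0550-3213(00)00429-6 = arXiv:hep-ph/0004013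
(v2; e-print source `sd_replaced170701.tex` deposited on the pub-qed HOME, `data/lit/sources/.cache/hep-ph_0004013/`,
PDF page texts `…/arxiv-pdf-pages/hep-ph_0004013v2/`). After the primary sectors (Part I, typed in
`Borinsky2020/HeppSectorDecomposition.lean`: `primarySector`, `integral_eq_sum_setIntegral_primarySector`) and the
iterated decomposition (Part II), every subsector integral has the form (tex l.403–407, eq. (EQ:subsec_form))
`G_{lk} = ∫_0^1 d^{N−1}t (∏_j t_j^{A_j − B_j ε}) 𝒰_{lk}^{N−(L+1)D/2} / ℱ_{lk}^{N−LD/2}` with «A_j, B_j … integers»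
and 𝒰, ℱ of the form (EQ:subsec_UF) `𝒰 = 1 + u(t)`, `ℱ = −s_0 + Σ_β (−s_β) f_β(t)` (tex l.421–427). Part III,
VERBATIM (arXiv v2 p. 6–7; tex l.461–509): «Explicitly, the following procedure has to be worked through for each
variable t_{j=1,…,N−1} and each subsector integrand: The integrand …, characterized by the respective exponents
A_j − B_j ε (j = 1,…,N−1) of t_j and the functions of the form (EQ:subsec_UF), can for each t_j be written as
  (14)  I_j = ∫_0^1 dt_j t_j^{(A_j − B_j ε)} ℐ(t_j, ε).
If A_j ≥ 0, the integration does not lead to an ε–pole. In this case no subtraction is needed and one can go to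
the next variable t_{j+1}. If A_j < 0, one expands ℐ(t_j, ε) into a Taylor series around t_j = 0. Using the
definition ℐ_j^{(p)}(0, ε) = ∂^p ℐ(t_j, ε)/∂t_j^p |_{t_j = 0}, one obtains
  (15)  ℐ(t_j, ε) = Σ_{p=0}^{|A_j|−1} ℐ_j^{(p)}(0, ε) t_j^p / p! + R(t_j, ε).
Now the pole part can be extracted easily, and one obtains
  (16)  I_j = Σ_{p=0}^{|A_j|−1} 1/(A_j + p + 1 − B_j ε) · ℐ_j^{(p)}(0, ε)/p! + ∫_0^1 dt_j t_j^{A_j − B_j ε} R(t_j, ε).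
By construction the integral containing the remainder term R(t_j, ε) does not get poles in ε from the
t_j-integration anymore. For example, in the generic case of a logarithmic divergence, A_j = −1, p = 0 and
R(t_j, ε) = ℐ(t_j, ε) − ℐ_j(0, ε). Since, as long as j < N − 1, the expression (16) still contains an overall
factor t_{j+1}^{A_{j+1} − B_{j+1} ε}, it is of the same form as (14) for j → j + 1 and the same steps as above
can be applied to it.» and (tex l.510–520) «After N − 1 steps all singular integrations are done analytically and
all poles are extracted. The resulting expression can be expanded in ε now.»

TYPING (one variable `t = t_j`, the other sector variables and `ε` held fixed, exactly as the printed «for each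
variable … and each subsector integrand»): the one-variable integrand is `f : ℝ → ℝ` (= `ℐ(·, ε)`; for ℱ of
definite sign it is smooth on `[0,1]`, and only that is used: `ContinuousOn f (Icc 0 1)` for the algebraic
identity, `ContDiffOn ℝ (n+1) f (Icc 0 1)` for the remainder statements), the REAL exponent `a : ℝ` plays
`A_j − B_j ε` (ε real, as in every numerical use of the algorithm; TODO(general form): complex `ε` via `Complex.cpow`,
same proofs on `re`), the Taylor data at `t_j = 0` are Mathlib's one-sided objects on `Icc 0 1`:
`ℐ_j^{(p)}(0, ε) = iteratedDerivWithin p f (Icc 0 1) 0`, the Taylor polynomial of (15) with `|A_j| − 1 = n` is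
`taylorWithinEval f n (Icc 0 1) 0 t = Σ_{p ≤ n} ℐ^{(p)}(0) t^p/p!` (`taylor_within_apply`), and
`R(t_j, ε) = f t − taylorWithinEval f n (Icc 0 1) 0 t`. PROVED (Mathlib only: `integral_rpow`, Taylor's theorem with
the polynomial remainder bound `exists_taylor_mean_remainder_bound`, dominated convergence
`intervalIntegral.continuousAt_of_dominated_interval`):
* `integral_rpow_mul_pow` — `∫_0^1 t^a t^p dt = 1/(a + p + 1)` (`a + p > −1`), the printed pole factor;
* `integral_rpow_mul_taylorWithinEval` — the pole part: `∫_0^1 t^a · (Σ_{p≤n} ℐ^{(p)}(0) t^p/p!) dt =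
  Σ_{p≤n} ℐ^{(p)}(0)/p! · 1/(a+p+1)` for `a > −1`;
* **`integral_rpow_mul_eq_sum_add_integral_remainder`** — eq. (16) as an identity of convergent integrals, i.e. on
  the half-line `a > −1` where (14) converges: `∫_0^1 t^a f = Σ_{p≤n} ℐ^{(p)}(0)/(p!(a+p+1)) + ∫_0^1 t^a R`;
* **`intervalIntegrable_rpow_mul_taylorRemainder`** — the remainder integral `∫_0^1 t^a R(t) dt` converges
  ABSOLUTELY for every `a > −(n+2) = A_j − 1` (from `|R(t)| ≤ C t^{n+1}`, `abs_taylorRemainder_le`), in particular at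
  and around `a = A_j = −(n+1)` (`ε = 0`);
* **`continuousOn_integral_rpow_mul_taylorRemainder`**, **`continuousAt_integral_rpow_mul_taylorRemainder`**,
  **`continuousAt_remainderIntegral_eps`** — «the integral containing the remainder term … does not get poles in ε
  from the t_j-integration anymore»: `a ↦ ∫_0^1 t^a R` is continuous on the whole half-line `a > −(n+2)`, hence at
  `a = A_j`, hence `ε ↦ ∫_0^1 t^{A_j − B ε} R` is continuous at `ε = 0` for every real `B` (TODO(general form):
  real-analytic in `a` there — the same domination argument on derivatives; continuity is what «no pole» needs);
* `intervalIntegrable_rpow_mul`, `continuousOn_integral_rpow_mul` — the clause «If A_j ≥ 0, the integration does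
  not lead to an ε–pole … no subtraction is needed»: for continuous `f` the unsubtracted `a ↦ ∫_0^1 t^a f` converges
  absolutely and is continuous on `a > −1 ⊇ {A_j − B_j ε : A_j ≥ 0, |B_j ε| < 1}`;
* the «generic case of a logarithmic divergence» `A_j = −1`, `p = 0`, `R = ℐ − ℐ_j(0)`, with `a = −1 + c`,
  `c = −B_j ε`: **`integral_rpow_mul_eq_pole_add_subtracted`** `∫_0^1 t^{c−1} f = f(0)/c + ∫_0^1 t^{c−1}(f − f(0))`
  (`c > 0`), `intervalIntegrable_rpow_mul_sub` / `intervalIntegrable_sub_div` (the subtracted integral converges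
  absolutely for `a > −2`; the finite part `∫_0^1 (f(t) − f(0))/t dt` converges absolutely for `f ∈ C¹[0,1]`),
  `continuousOn_integral_rpow_mul_sub`, `continuousAt_integral_rpow_mul_sub_eps`, `integral_rpow_neg_one_mul_sub`,
  **`tendsto_integral_rpow_mul_sub_eps`** (the subtracted integral is continuous in `c` through `c = 0` and tends,
  as `ε → 0`, to that finite part: the Laurent structure `ℐ(0)/c + finite part + o(1)` of (14) in the log case).
So the RIGHT side of (16) is defined and pole-free on `a > −(n+2)` except for the explicit factors
`1/(A_j + p + 1 − B_j ε)`, and agrees with the LEFT side wherever the latter converges — the one-variable content of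
«all poles are extracted … can be expanded in ε now»; with `a = −(n+1) + c` the `p = n` factor is `1/c = −1/(B_j ε)`
and the `p < n` factors `1/(c − (n − p))` are regular at `c = 0` (plain arithmetic, not separately typed).
NOT typed here: the (N−1)-fold iteration over the variables and the Laurent bookkeeping (17)
`G_{lk} = Σ_{m=0}^{2L} C_{lk,m}/ε^m + 𝒪(ε)` (each step is this file applied under the remaining integrals; the
«at most 1/ε^{2L}» count is a statement about which `A_j` occur, i.e. about the graph), Part II's decomposition
strategy and its termination (Binoth–Heinrich's choice rule can loop — Bogner–Weinzierl 2008), Part IV (numerics,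
«ℱ of definite sign»), and anything about a SIGNED SUM of differently structured terms finite only in the sum —
the print subtracts per sector variable, in the sector's own coordinates, after decomposition (the pub-qed TROPICAL
track's `tropical/lit/SOURCES.md` §4.4 / §4.6 (a) records this scope verbatim). Filed by the track's literature seat
`pub-qed-trop-lit` gen 22 as the kernel object behind SOURCES §4.4; VALUE-FREE (identities and convergence
statements about one-dimensional integrals `∫_0^1 t^a g(t) dt`; nothing per graph, word or class); independent
recomputation; certified where stated, statistical where stated; no new-physics claim.
-/

namespace Literature.MathematicalPhysics.QuantumFieldTheory.BinothHeinrich2000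

open MeasureTheory Set Filter Topology intervalIntegral
open scoped Interval Nat

/-! ### Engine: `∫_0^1 t^a g(t) dt` for `|g(t)| ≤ C t^m` — absolute convergence for `a > −(m+1)` and continuity in `a` -/

/-- Measurability plumbing: `t ↦ t^a g(t)` is a.e.-strongly measurable on `Ι 0 1 = (0,1]` for `g` continuous on
`[0,1]`. [cite: BinothHeinrich2000, Part III eq. (14) (arXiv v2 p.6; tex l.471–479)] -/
theorem aestronglyMeasurable_rpow_mul {g : ℝ → ℝ} (hg : ContinuousOn g (Icc 0 1)) (a : ℝ) :
    AEStronglyMeasurable (fun t : ℝ => t ^ a * g t) (volume.restrict (Ι (0 : ℝ) 1)) := by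
  rw [uIoc_of_le zero_le_one]
  refine ContinuousOn.aestronglyMeasurable ?_ measurableSet_Ioc
  exact (continuousOn_id.rpow_const fun t ht => Or.inl (ne_of_gt ht.1)).mul
    (hg.mono Ioc_subset_Icc_self)

/-- The pointwise domination on `(0,1]`: if `|g(t)| ≤ C t^m` on `[0,1]` and `a₀ ≤ a`, then
`‖t^a g(t)‖ ≤ C t^{a₀ + m}` for `t ∈ (0,1]` (since `t^a ≤ t^{a₀}` there). [cite: BinothHeinrich2000, Part III (tex l.497–499: «By construction the integral containing the remainder term … does not get poles»)] -/
theorem norm_rpow_mul_le_of_abs_le_mul_pow {g : ℝ → ℝ} {m : ℕ} {C a₀ a t : ℝ}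
    (hle : ∀ t ∈ Icc (0 : ℝ) 1, |g t| ≤ C * t ^ m) (ha : a₀ ≤ a) (ht : t ∈ Ioc (0 : ℝ) 1) :
    ‖t ^ a * g t‖ ≤ C * t ^ (a₀ + m) := by
  have ht0 : 0 < t := ht.1
  rw [Real.norm_eq_abs, abs_mul, abs_of_nonneg (Real.rpow_nonneg ht0.le a),
    Real.rpow_add_natCast ht0.ne']
  calc t ^ a * |g t| ≤ t ^ a₀ * (C * t ^ m) :=
        mul_le_mul (Real.rpow_le_rpow_of_exponent_ge ht0 ht.2 ha) (hle t ⟨ht0.le, ht.2⟩)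
          (abs_nonneg _) (Real.rpow_nonneg ht0.le a₀)
    _ = C * (t ^ a₀ * t ^ m) := by ring

/-- **Absolute convergence from a power bound.** If `g` is continuous on `[0,1]` with `|g(t)| ≤ C t^m`, then
`∫_0^1 t^a g(t) dt` converges absolutely for every real `a > −(m+1)` (domination by `C t^{a+m}`, integrable iff
`a + m > −1`). With `g = R`, `m = |A_j|` this is why «the integral containing the remainder term R(t_j, ε)» in
eq. (16) exists down to and beyond `a = A_j`. [cite: BinothHeinrich2000, Part III eq. (16) (arXiv v2 p.7; tex l.488–499)] -/
theorem intervalIntegrable_rpow_mul_of_abs_le_mul_pow {g : ℝ → ℝ} {m : ℕ} {C a : ℝ}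
    (hg : ContinuousOn g (Icc 0 1)) (hle : ∀ t ∈ Icc (0 : ℝ) 1, |g t| ≤ C * t ^ m)
    (ha : -(m + 1 : ℝ) < a) :
    IntervalIntegrable (fun t : ℝ => t ^ a * g t) volume 0 1 := by
  have hdom : IntervalIntegrable (fun t : ℝ => C * t ^ (a + m)) volume 0 1 :=
    (intervalIntegral.intervalIntegrable_rpow' (a := 0) (b := 1)
      (show -1 < a + m by linarith)).const_mul C
  rw [intervalIntegrable_iff] at hdom ⊢
  refine MeasureTheory.Integrable.mono' hdom (aestronglyMeasurable_rpow_mul hg a) ?_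
  rw [uIoc_of_le zero_le_one]
  refine (ae_restrict_iff' measurableSet_Ioc).2 (Eventually.of_forall fun t ht => ?_)
  exact norm_rpow_mul_le_of_abs_le_mul_pow hle le_rfl ht

/-- **No pole from a dominated integral: continuity in the exponent.** If `g` is continuous on `[0,1]` with
`|g(t)| ≤ C t^m`, then `a ↦ ∫_0^1 t^a g(t) dt` is continuous on the open half-line `a > −(m+1)` (dominated
convergence with the bound `C t^{a₀+m}`, `a₀` strictly between `−(m+1)` and the point). With `g = R`, `m = |A_j|`
this is «the integral containing the remainder term R(t_j, ε) does not get poles in ε from the t_j-integration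
anymore». [cite: BinothHeinrich2000, Part III, sentence after eq. (16) (arXiv v2 p.7; tex l.497–499)] -/
theorem continuousOn_integral_rpow_mul_of_abs_le_mul_pow {g : ℝ → ℝ} {m : ℕ} {C : ℝ}
    (hg : ContinuousOn g (Icc 0 1)) (hle : ∀ t ∈ Icc (0 : ℝ) 1, |g t| ≤ C * t ^ m) :
    ContinuousOn (fun a : ℝ => ∫ t in (0 : ℝ)..1, t ^ a * g t) (Ioi (-(m + 1 : ℝ))) := by
  intro a₁ ha₁
  obtain ⟨a₀, h₀, h₁⟩ := exists_between (mem_Ioi.1 ha₁)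
  refine ContinuousAt.continuousWithinAt ?_
  refine intervalIntegral.continuousAt_of_dominated_interval
    (F := fun a t => t ^ a * g t) (bound := fun t => C * t ^ (a₀ + m)) ?_ ?_ ?_ ?_
  · exact Eventually.of_forall fun a => aestronglyMeasurable_rpow_mul hg a
  · filter_upwards [Ioi_mem_nhds h₁] with a ha
    refine Eventually.of_forall fun t ht => ?_
    rw [uIoc_of_le zero_le_one] at ht
    exact norm_rpow_mul_le_of_abs_le_mul_pow hle (le_of_lt ha) ht
  · exact (intervalIntegral.intervalIntegrable_rpow' (a := 0) (b := 1)
      (show -1 < a₀ + m by linarith)).const_mul C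
  · refine Eventually.of_forall fun t ht => ?_
    rw [uIoc_of_le zero_le_one] at ht
    exact ((Real.continuous_const_rpow ht.1.ne').mul continuous_const).continuousAt

/-! ### The pole factors: `∫_0^1 t^a t^p dt = 1/(a+p+1)` and the pole part of eq. (16) -/

/-- `∫_0^1 t^a · t^p dt = 1/(a + p + 1)` for `a + p > −1` — the factor `1/(A_j + p + 1 − B_j ε)` of eq. (16) with
`a = A_j − B_j ε`. [cite: BinothHeinrich2000, Part III eq. (16) (arXiv v2 p.7; tex l.488–494)] -/
theorem integral_rpow_mul_pow {a : ℝ} (p : ℕ) (h : -1 < a + p) :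
    ∫ t in (0 : ℝ)..1, t ^ a * t ^ p = 1 / (a + p + 1) := by
  have h1 : ∫ t in (0 : ℝ)..1, t ^ a * t ^ p = ∫ t in (0 : ℝ)..1, t ^ (a + p) := by
    refine intervalIntegral.integral_congr_ae (Eventually.of_forall fun t ht => ?_)
    rw [uIoc_of_le zero_le_one] at ht
    rw [Real.rpow_add_natCast ht.1.ne']
  rw [h1, integral_rpow (Or.inl h), Real.one_rpow, Real.zero_rpow (by linarith), sub_zero]

/-- The Taylor polynomial `t ↦ Σ_{p≤n} ℐ^{(p)}(x₀) (t − x₀)^p/p!` is continuous in `t` (it is a polynomial).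
Plumbing for eq. (15). [cite: BinothHeinrich2000, Part III eq. (15) (arXiv v2 p.6; tex l.480–487)] -/
theorem continuous_taylorWithinEval (f : ℝ → ℝ) (n : ℕ) (s : Set ℝ) (x₀ : ℝ) :
    Continuous fun t => taylorWithinEval f n s x₀ t := by
  have h : (fun t => taylorWithinEval f n s x₀ t) = fun t =>
      ∑ k ∈ Finset.range (n + 1), ((k ! : ℝ)⁻¹ * (t - x₀) ^ k) • iteratedDerivWithin k f s x₀ := by
    funext t
    exact taylor_within_apply f n s x₀ t
  rw [h]
  fun_prop

/-- **The pole part of eq. (16).** Integrating `t^a` against the Taylor polynomial (15) term by term: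
`∫_0^1 t^a Σ_{p≤n} ℐ^{(p)}(0) t^p/p! dt = Σ_{p≤n} ℐ^{(p)}(0)/p! · 1/(a + p + 1)` for `a > −1`. [cite: BinothHeinrich2000, Part III eqs. (15)–(16) (arXiv v2 p.6–7; tex l.480–494)] -/
theorem integral_rpow_mul_taylorWithinEval (f : ℝ → ℝ) (n : ℕ) {a : ℝ} (ha : -1 < a) :
    ∫ t in (0 : ℝ)..1, t ^ a * taylorWithinEval f n (Icc 0 1) 0 t =
      ∑ p ∈ Finset.range (n + 1), iteratedDerivWithin p f (Icc 0 1) 0 / p ! / (a + p + 1) := by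
  have h1 : (fun t : ℝ => t ^ a * taylorWithinEval f n (Icc 0 1) 0 t) = fun t =>
      ∑ p ∈ Finset.range (n + 1), (iteratedDerivWithin p f (Icc 0 1) 0 / p !) * (t ^ a * t ^ p) := by
    funext t
    rw [taylor_within_apply, Finset.mul_sum]
    refine Finset.sum_congr rfl fun p _ => ?_
    rw [smul_eq_mul, sub_zero]
    ring
  rw [h1, intervalIntegral.integral_finsetSum]
  · refine Finset.sum_congr rfl fun p _ => ?_
    have hp : -1 < a + p := by
      have : (0 : ℝ) ≤ p := Nat.cast_nonneg p
      linarith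
    rw [intervalIntegral.integral_const_mul, integral_rpow_mul_pow p hp]
    have hne : a + p + 1 ≠ 0 := by linarith
    field_simp
  · intro p _
    exact ((intervalIntegral.intervalIntegrable_rpow' (a := 0) (b := 1) ha).mul_continuousOn
      ((continuous_pow p).continuousOn)).const_mul _

/-! ### «If A_j ≥ 0, the integration does not lead to an ε–pole» -/

/-- For continuous `ℐ` the unsubtracted integral (14) `∫_0^1 t^a ℐ(t) dt` converges absolutely for every `a > −1`,
which contains `a = A_j − B_j ε` for all `A_j ≥ 0` and `|B_j ε| < 1`: «In this case no subtraction is needed».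
[cite: BinothHeinrich2000, Part III, sentence after eq. (14) (arXiv v2 p.6; tex l.479–481)] -/
theorem intervalIntegrable_rpow_mul {f : ℝ → ℝ} (hf : ContinuousOn f (Icc 0 1)) {a : ℝ} (ha : -1 < a) :
    IntervalIntegrable (fun t : ℝ => t ^ a * f t) volume 0 1 :=
  (intervalIntegral.intervalIntegrable_rpow' (a := 0) (b := 1) ha).mul_continuousOn
    (by rwa [uIcc_of_le zero_le_one])

/-- «If A_j ≥ 0, the integration does not lead to an ε–pole»: for continuous `ℐ` the unsubtracted
`a ↦ ∫_0^1 t^a ℐ(t) dt` is continuous on the half-line `a > −1` (so, with `a = A_j − B_j ε` and `A_j ≥ 0`, continuous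
in `ε` near `ε = 0`). [cite: BinothHeinrich2000, Part III, sentence after eq. (14) (arXiv v2 p.6; tex l.479–481)] -/
theorem continuousOn_integral_rpow_mul {f : ℝ → ℝ} (hf : ContinuousOn f (Icc 0 1)) :
    ContinuousOn (fun a : ℝ => ∫ t in (0 : ℝ)..1, t ^ a * f t) (Ioi (-1 : ℝ)) := by
  obtain ⟨C, hC⟩ := isCompact_Icc.exists_bound_of_continuousOn hf
  have hle : ∀ t ∈ Icc (0 : ℝ) 1, |f t| ≤ C * t ^ (0 : ℕ) := fun t ht => by
    simpa [Real.norm_eq_abs] using hC t ht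
  simpa using continuousOn_integral_rpow_mul_of_abs_le_mul_pow (m := 0) hf hle

/-! ### Eq. (16): the subtraction identity and its remainder integral -/

/-- **Eq. (16) of Binoth–Heinrich, as an identity of convergent integrals.** For `ℐ` continuous on `[0,1]`, every
Taylor order `n` (= `|A_j| − 1`) and every exponent `a > −1` (the half-line on which the left side (14) converges):
`∫_0^1 t^a ℐ(t) dt = Σ_{p=0}^{n} ℐ^{(p)}(0)/p! · 1/(a + p + 1) + ∫_0^1 t^a R(t) dt`, `R = ℐ − Σ_{p≤n} ℐ^{(p)}(0) t^p/p!`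
(one-sided derivatives at `0` within `[0,1]`). The right side is the printed pole extraction; its integral is
pole-free beyond `a = −1` by the theorems below. [cite: BinothHeinrich2000, Part III eqs. (14)–(16) (arXiv v2 p.6–7; tex l.471–494)] -/
theorem integral_rpow_mul_eq_sum_add_integral_remainder {f : ℝ → ℝ} (hf : ContinuousOn f (Icc 0 1)) (n : ℕ)
    {a : ℝ} (ha : -1 < a) :
    ∫ t in (0 : ℝ)..1, t ^ a * f t =
      (∑ p ∈ Finset.range (n + 1), iteratedDerivWithin p f (Icc 0 1) 0 / p ! / (a + p + 1)) +
        ∫ t in (0 : ℝ)..1, t ^ a * (f t - taylorWithinEval f n (Icc 0 1) 0 t) := by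
  have hP : Continuous fun t => taylorWithinEval f n (Icc 0 1) 0 t := continuous_taylorWithinEval f n _ 0
  have hf' : ContinuousOn f (uIcc (0 : ℝ) 1) := by rwa [uIcc_of_le zero_le_one]
  have hiP : IntervalIntegrable (fun t : ℝ => t ^ a * taylorWithinEval f n (Icc 0 1) 0 t) volume 0 1 :=
    (intervalIntegral.intervalIntegrable_rpow' (a := 0) (b := 1) ha).mul_continuousOn hP.continuousOn
  have hiR : IntervalIntegrable
      (fun t : ℝ => t ^ a * (f t - taylorWithinEval f n (Icc 0 1) 0 t)) volume 0 1 :=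
    (intervalIntegral.intervalIntegrable_rpow' (a := 0) (b := 1) ha).mul_continuousOn
      (hf'.sub hP.continuousOn)
  have hsplit : (fun t : ℝ => t ^ a * f t) = fun t =>
      t ^ a * taylorWithinEval f n (Icc 0 1) 0 t + t ^ a * (f t - taylorWithinEval f n (Icc 0 1) 0 t) := by
    funext t
    ring
  rw [hsplit, intervalIntegral.integral_add hiP hiR, integral_rpow_mul_taylorWithinEval f n ha]

/-- **Taylor's bound on the remainder of (15)**: for `ℐ ∈ C^{n+1}[0,1]`, `|R(t)| ≤ C t^{n+1}` on `[0,1]`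
(Mathlib's `exists_taylor_mean_remainder_bound`, the «By construction» of the source).
[cite: BinothHeinrich2000, Part III eq. (15) (arXiv v2 p.6; tex l.480–487)] -/
theorem abs_taylorRemainder_le {f : ℝ → ℝ} {n : ℕ} (hf : ContDiffOn ℝ (n + 1) f (Icc 0 1)) :
    ∃ C : ℝ, ∀ t ∈ Icc (0 : ℝ) 1, |f t - taylorWithinEval f n (Icc 0 1) 0 t| ≤ C * t ^ (n + 1) := by
  obtain ⟨C, hC⟩ := exists_taylor_mean_remainder_bound zero_le_one hf
  exact ⟨C, fun t ht => by simpa [Real.norm_eq_abs] using hC t ht⟩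

/-- The remainder `R = ℐ − (Taylor polynomial)` is continuous on `[0,1]`. Plumbing.
[cite: BinothHeinrich2000, Part III eq. (15) (arXiv v2 p.6; tex l.480–487)] -/
theorem continuousOn_taylorRemainder {f : ℝ → ℝ} (hf : ContinuousOn f (Icc 0 1)) (n : ℕ) :
    ContinuousOn (fun t => f t - taylorWithinEval f n (Icc 0 1) 0 t) (Icc 0 1) :=
  hf.sub (continuous_taylorWithinEval f n _ 0).continuousOn

/-- **The remainder integral of eq. (16) converges absolutely beyond the pole**: for `ℐ ∈ C^{n+1}[0,1]` and every
real `a > −(n+2)` — in particular at `a = A_j = −(n+1)` (`ε = 0`) and in a full neighbourhood of it —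
`t ↦ t^a R(t)` is integrable on `(0,1)`. [cite: BinothHeinrich2000, Part III eq. (16) and the sentence after it (arXiv v2 p.7; tex l.488–499)] -/
theorem intervalIntegrable_rpow_mul_taylorRemainder {f : ℝ → ℝ} {n : ℕ}
    (hf : ContDiffOn ℝ (n + 1) f (Icc 0 1)) {a : ℝ} (ha : -(n + 2 : ℝ) < a) :
    IntervalIntegrable (fun t : ℝ => t ^ a * (f t - taylorWithinEval f n (Icc 0 1) 0 t)) volume 0 1 := by
  obtain ⟨C, hC⟩ := abs_taylorRemainder_le hf
  exact intervalIntegrable_rpow_mul_of_abs_le_mul_pow (m := n + 1) (continuousOn_taylorRemainder hf.continuousOn n)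
    hC (by push_cast; linarith)

/-- **«… does not get poles in ε from the t_j-integration anymore.»** For `ℐ ∈ C^{n+1}[0,1]` the remainder
integral `a ↦ ∫_0^1 t^a R(t) dt` of eq. (16) is continuous on the whole open half-line `a > −(n+2)`, which contains
`a = A_j = −(n+1)`. [cite: BinothHeinrich2000, Part III, sentence after eq. (16) (arXiv v2 p.7; tex l.497–499)] -/
theorem continuousOn_integral_rpow_mul_taylorRemainder {f : ℝ → ℝ} {n : ℕ}
    (hf : ContDiffOn ℝ (n + 1) f (Icc 0 1)) :
    ContinuousOn (fun a : ℝ => ∫ t in (0 : ℝ)..1, t ^ a * (f t - taylorWithinEval f n (Icc 0 1) 0 t))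
      (Ioi (-(n + 2 : ℝ))) := by
  obtain ⟨C, hC⟩ := abs_taylorRemainder_le hf
  have h := continuousOn_integral_rpow_mul_of_abs_le_mul_pow (m := n + 1)
    (continuousOn_taylorRemainder hf.continuousOn n) hC
  have e : (-(((n + 1 : ℕ) : ℝ) + 1)) = -(n + 2 : ℝ) := by push_cast; ring
  rwa [e] at h

/-- The same at the printed point: the remainder integral of eq. (16) is continuous in the exponent AT `a = A_j =
−(n+1)`. [cite: BinothHeinrich2000, Part III, sentence after eq. (16) (arXiv v2 p.7; tex l.497–499)] -/
theorem continuousAt_integral_rpow_mul_taylorRemainder {f : ℝ → ℝ} {n : ℕ}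
    (hf : ContDiffOn ℝ (n + 1) f (Icc 0 1)) :
    ContinuousAt (fun a : ℝ => ∫ t in (0 : ℝ)..1, t ^ a * (f t - taylorWithinEval f n (Icc 0 1) 0 t))
      (-(n + 1 : ℝ)) :=
  (continuousOn_integral_rpow_mul_taylorRemainder hf).continuousAt (Ioi_mem_nhds (by linarith))

/-- **In the regulator:** with `a = A_j − B_j ε`, `A_j = −(n+1)` and ANY real `B_j`, the remainder integral of
eq. (16) `ε ↦ ∫_0^1 t^{A_j − B_j ε} R(t, ·) dt` is continuous at `ε = 0` — no pole in `ε` «from the t_j-integration».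
[cite: BinothHeinrich2000, Part III, sentence after eq. (16) (arXiv v2 p.7; tex l.497–499)] -/
theorem continuousAt_remainderIntegral_eps {f : ℝ → ℝ} {n : ℕ} (hf : ContDiffOn ℝ (n + 1) f (Icc 0 1))
    (B : ℝ) :
    ContinuousAt (fun ε : ℝ =>
      ∫ t in (0 : ℝ)..1, t ^ (-(n + 1 : ℝ) - B * ε) * (f t - taylorWithinEval f n (Icc 0 1) 0 t)) 0 := by
  have hlin : ContinuousAt (fun ε : ℝ => -(n + 1 : ℝ) - B * ε) 0 := by fun_prop
  exact (continuousAt_integral_rpow_mul_taylorRemainder hf).comp_of_eq hlin (by simp)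

/-! ### «The generic case of a logarithmic divergence, A_j = −1, p = 0 and R(t_j, ε) = ℐ(t_j, ε) − ℐ_j(0, ε)» -/

/-- **Eq. (16) in the logarithmic case** `A_j = −1` (`n = 0`), written with `a = −1 + c`, `c = −B_j ε > 0`:
`∫_0^1 t^{c−1} ℐ(t) dt = ℐ(0)/c + ∫_0^1 t^{c−1} (ℐ(t) − ℐ(0)) dt` for continuous `ℐ`.
[cite: BinothHeinrich2000, Part III eq. (16) with «A_j = −1, p = 0 and R = ℐ − ℐ_j(0)» (arXiv v2 p.7; tex l.488–500)] -/
theorem integral_rpow_mul_eq_pole_add_subtracted {f : ℝ → ℝ} (hf : ContinuousOn f (Icc 0 1)) {c : ℝ}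
    (hc : 0 < c) :
    ∫ t in (0 : ℝ)..1, t ^ (c - 1) * f t = f 0 / c + ∫ t in (0 : ℝ)..1, t ^ (c - 1) * (f t - f 0) := by
  have h := integral_rpow_mul_eq_sum_add_integral_remainder hf 0 (a := c - 1) (by linarith)
  simpa using h

/-- The logarithmic case's subtracted integral converges absolutely for every `a > −2`, `ℐ ∈ C¹[0,1]`.
[cite: BinothHeinrich2000, Part III, «A_j = −1, p = 0 and R = ℐ − ℐ_j(0)» (arXiv v2 p.7; tex l.497–500)] -/
theorem intervalIntegrable_rpow_mul_sub {f : ℝ → ℝ} (hf : ContDiffOn ℝ 1 f (Icc 0 1)) {a : ℝ} (ha : -2 < a) :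
    IntervalIntegrable (fun t : ℝ => t ^ a * (f t - f 0)) volume 0 1 := by
  have hf' : ContDiffOn ℝ ((0 : ℕ) + 1) f (Icc 0 1) := by simpa using hf
  simpa using intervalIntegrable_rpow_mul_taylorRemainder hf' (a := a) (by push_cast; linarith)

/-- **The finite part at `ε = 0` exists:** for `ℐ ∈ C¹[0,1]`, `∫_0^1 (ℐ(t) − ℐ(0))/t dt` converges absolutely.
[cite: BinothHeinrich2000, Part III, «A_j = −1, p = 0 and R = ℐ − ℐ_j(0)» (arXiv v2 p.7; tex l.497–500)] -/
theorem intervalIntegrable_sub_div {f : ℝ → ℝ} (hf : ContDiffOn ℝ 1 f (Icc 0 1)) :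
    IntervalIntegrable (fun t : ℝ => (f t - f 0) / t) volume 0 1 := by
  have h := intervalIntegrable_rpow_mul_sub hf (a := -1) (by norm_num)
  refine h.congr fun t _ => ?_
  simp only [Real.rpow_neg_one, inv_mul_eq_div]

/-- The logarithmic case's subtracted integral `a ↦ ∫_0^1 t^a (ℐ(t) − ℐ(0)) dt` is continuous on `a > −2`, for
`ℐ ∈ C¹[0,1]`. [cite: BinothHeinrich2000, Part III, sentence after eq. (16) (arXiv v2 p.7; tex l.497–500)] -/
theorem continuousOn_integral_rpow_mul_sub {f : ℝ → ℝ} (hf : ContDiffOn ℝ 1 f (Icc 0 1)) :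
    ContinuousOn (fun a : ℝ => ∫ t in (0 : ℝ)..1, t ^ a * (f t - f 0)) (Ioi (-2 : ℝ)) := by
  have hf' : ContDiffOn ℝ ((0 : ℕ) + 1) f (Icc 0 1) := by simpa using hf
  have h := continuousOn_integral_rpow_mul_taylorRemainder hf'
  norm_num at h
  simpa using h

/-- **No pole at `ε = 0` in the logarithmic case:** with `c = −B_j ε`, the subtracted integral
`c ↦ ∫_0^1 t^{c−1} (ℐ(t) − ℐ(0)) dt` is continuous at `c = 0`, `ℐ ∈ C¹[0,1]`.
[cite: BinothHeinrich2000, Part III, sentence after eq. (16) (arXiv v2 p.7; tex l.497–500)] -/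
theorem continuousAt_integral_rpow_mul_sub_eps {f : ℝ → ℝ} (hf : ContDiffOn ℝ 1 f (Icc 0 1)) :
    ContinuousAt (fun c : ℝ => ∫ t in (0 : ℝ)..1, t ^ (c - 1) * (f t - f 0)) 0 := by
  have h1 : ContinuousAt (fun a : ℝ => ∫ t in (0 : ℝ)..1, t ^ a * (f t - f 0)) (-1) :=
    (continuousOn_integral_rpow_mul_sub hf).continuousAt (Ioi_mem_nhds (by norm_num))
  have hlin : ContinuousAt (fun c : ℝ => c - 1) 0 := by fun_prop
  exact h1.comp_of_eq hlin (by simp)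

/-- … and its value at `c = 0` (`a = −1`) is the finite part `∫_0^1 (ℐ(t) − ℐ(0))/t dt`.
[cite: BinothHeinrich2000, Part III, «A_j = −1, p = 0 and R = ℐ − ℐ_j(0)» (arXiv v2 p.7; tex l.497–500)] -/
theorem integral_rpow_neg_one_mul_sub (f : ℝ → ℝ) :
    ∫ t in (0 : ℝ)..1, t ^ (-1 : ℝ) * (f t - f 0) = ∫ t in (0 : ℝ)..1, (f t - f 0) / t := by
  refine intervalIntegral.integral_congr fun t _ => ?_
  simp only [Real.rpow_neg_one, inv_mul_eq_div]

/-- **The limit `ε → 0` of the subtracted integral is the finite part**: for `ℐ ∈ C¹[0,1]`,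
`∫_0^1 t^{c−1} (ℐ(t) − ℐ(0)) dt → ∫_0^1 (ℐ(t) − ℐ(0))/t dt` as `c = −B_j ε → 0` (two-sided). Together with
`integral_rpow_mul_eq_pole_add_subtracted` this is the printed Laurent structure of (14) in the logarithmic case:
`ℐ(0)/c + (finite part) + o(1)`. [cite: BinothHeinrich2000, Part III eq. (16) and the two sentences after it (arXiv v2 p.7; tex l.488–500)] -/
theorem tendsto_integral_rpow_mul_sub_eps {f : ℝ → ℝ} (hf : ContDiffOn ℝ 1 f (Icc 0 1)) :
    Tendsto (fun c : ℝ => ∫ t in (0 : ℝ)..1, t ^ (c - 1) * (f t - f 0)) (𝓝 0)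
      (𝓝 (∫ t in (0 : ℝ)..1, (f t - f 0) / t)) := by
  have h := (continuousAt_integral_rpow_mul_sub_eps hf).tendsto
  simp only [zero_sub] at h
  rwa [integral_rpow_neg_one_mul_sub] at h

end Literature.MathematicalPhysics.QuantumFieldTheory.BinothHeinrich2000
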